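import Summits.CriticalPhenomena.Ising3DConformalLimit.Theses.PositivityBegetsConformality
import Summits.CriticalPhenomena.Ising3DConformalLimit.Theses.HyperoctahedralRP
import Summits.CriticalPhenomena.Ising3DConformalLimit.Theorems.PerfectScreeningMoebiusLimitExistsInversionPositive
import Summits.CriticalPhenomena.Ising3DConformalLimit.Theorems.PositivityBegetsConformalityInversionPositiveLimitLevelFour
import Summits.CriticalPhenomena.Ising3DConformalLimit.Theorems.PositivityBegetsConformalityInversionPositiveLimitStrata
import HarnessLib

/-!
# Census r1, `## Decomposition`, Split A (level split) — typed, assembly kernel-checked, NOT filed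

`X := InversionPositiveLimit` (stmt-4671) `⟸ LevelFour ∧ PropagationFromFour`, where

* `LevelFour` : every admissible limit has an inversion-covariant FOUR-point function
  (= item stmt-4672 `FourPointConeMembership` by the landed `fourPointConeMembership_iff_levelFour`, p155847);
* `PropagationFromFour` : for admissible EUCLIDEAN-invariant limits, level-4 inversion covariance
  propagates to `IsInversionCovariant Δ S` (all levels).

The seam `X_of_subs` is modus ponens through item 1982 (`crux ⟺ 1982`, p141302).  Recorded for the
census only: the open piece `PropagationFromFour` has NO plan (model-blindly false —
`fourPoint_does_not_propagate` / `sixFamily` in `Cruxes/InversionUpgradeNormalised/Disproof.lean` — and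
no Ising-specific mechanism is known), and `LevelFour` is itself Polyakov's conjecture at four points.
-/

namespace Summit.CriticalPhenomena.Ising3DConformalLimit.Cruxes.InversionPositiveLimit.StrategyCensusR1

open Literature.Probability.LatticeModels
open Summit.CriticalPhenomena.Ising3DConformalLimit.Theses
open Summit.CriticalPhenomena.Ising3DConformalLimit.MoebiusLimitExistsInversionPositive

/-- Piece 1 (= item stmt-4672 in level form): inversion covariance of `S 4` for every admissible limit. -/
def LevelFour : Prop :=
  ∀ (ρ : ℝ → ℝ) (Δ : ℝ) (S : CorrFamily 3), (∀ δ ∈ Set.Ioc (0:ℝ) 1, 0 < ρ δ) →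
    HasPointwiseScalingLimit (criticalCorr 3) ρ S → (∀ n z, z ∉ NonCoincident 3 n → S n z = 0) →
    IsNondegenerateTwoPoint S → IsTranslationInvariant S → IsScaleCovariant Δ S →
    ∀ x : Fin 4 → EuclideanSpace ℝ (Fin 3), (∀ i, x i ≠ 0) →
      S 4 (fun i => EuclideanGeometry.inversion 0 1 (x i)) = (∏ i, ‖x i‖ ^ (2 * Δ)) * S 4 x

/-- Piece 2 (open, unplanned): level-4 inversion covariance of an admissible Euclidean-invariant limit
propagates to all levels. -/
def PropagationFromFour : Prop :=
  ∀ (ρ : ℝ → ℝ) (Δ : ℝ) (S : CorrFamily 3), (∀ δ ∈ Set.Ioc (0:ℝ) 1, 0 < ρ δ) →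
    HasPointwiseScalingLimit (criticalCorr 3) ρ S → (∀ n z, z ∉ NonCoincident 3 n → S n z = 0) →
    IsNondegenerateTwoPoint S → IsEuclideanInvariant S → IsScaleCovariant Δ S →
    (∀ x : Fin 4 → EuclideanSpace ℝ (Fin 3), (∀ i, x i ≠ 0) →
      S 4 (fun i => EuclideanGeometry.inversion 0 1 (x i)) = (∏ i, ‖x i‖ ^ (2 * Δ)) * S 4 x) →
    IsInversionCovariant Δ S

/-- The seam: `LevelFour → PropagationFromFour → X` (through item 1982). -/
theorem X_of_subs (h4 : LevelFour) (hP : PropagationFromFour) :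
    PositivityBegetsConformality.InversionPositiveLimit := by
  apply inversionPositiveLimit_of_inversionUpgradeNormalised
  intro ρ Δ S hρ hlim hnorm hnd heuc hsc
  exact hP ρ Δ S hρ hlim hnorm hnd heuc hsc (h4 ρ Δ S hρ hlim hnorm hnd heuc.1 hsc)

/-- Exactness, half 1: `X → LevelFour` (landed chain crux ⇒ 4672 ⇒ level four). -/
theorem levelFour_of_X (h : PositivityBegetsConformality.InversionPositiveLimit) : LevelFour :=
  Summit.CriticalPhenomena.Ising3DConformalLimit.InversionPositiveLimitLevelFour.fourPointConeMembership_iff_levelFour.1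
    (Summit.CriticalPhenomena.Ising3DConformalLimit.PositivityBegetsConformalityInversionPositiveLimit.fourPointConeMembership_of_inversionPositiveLimit
      h)

/-- Exactness, half 2: `X → PropagationFromFour` (trivially: X gives the conclusion outright). -/
theorem propagation_of_X (h : PositivityBegetsConformality.InversionPositiveLimit) : PropagationFromFour := by
  intro ρ Δ S hρ hlim hnorm hnd heuc hsc _
  exact inversionUpgradeNormalised_of_inversionPositiveLimit h ρ Δ S hρ hlim hnorm hnd heuc hsc

/-- The split is exact: `X ↔ LevelFour ∧ PropagationFromFour`. -/
theorem X_iff_subs : PositivityBegetsConformality.InversionPositiveLimit ↔ (LevelFour ∧ PropagationFromFour) :=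
  ⟨fun h => ⟨levelFour_of_X h, propagation_of_X h⟩, fun h => X_of_subs h.1 h.2⟩

-- cheap piece probes (BC2 (c) shape): each must FAIL; uncomment to re-run.
-- example : LevelFour → PositivityBegetsConformality.InversionPositiveLimit := by
--   first | exact? | simpa [LevelFour] | aesop
-- example : PropagationFromFour → PositivityBegetsConformality.InversionPositiveLimit := by
--   first | exact? | simpa [PropagationFromFour] | aesop

end Summit.CriticalPhenomena.Ising3DConformalLimit.Cruxes.InversionPositiveLimit.StrategyCensusR1
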